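import Literature.NumberTheory.Weil1964.AdelicSchwartzDominatedTwists
import HarnessLib

/-!
# Dominated families II: uniform decay data give ONE Schwartz–Bruhat majorant; chirps and twists preserve domination

Topic `NumberTheory/Weil1964`; namespace `Literature.NumberTheory.Weil1964`.  KERNEL mathematics only (theorems; no
definition, no named fact, no `axiom`, no proof hole).

The tree proves continuity of adelic theta series of a representation `ρ` of «local formula» type from DECAY DATA
(★ `AdelicThetaMajorants.HasThetaMajorants.of_decay`): near every point all `ρ(g)Φ` are bounded by ONE
`M (1 + ‖x_∞‖)^{-k}` and vanish off ONE compact set of finite parts, which yields a summable majorant over the rational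
points ([Weil1964] Chap. III n° 41, Lemme 5).  Weil's boundedness lemmas for the Siegel formula ([Weil1965] Chap. V
n° 50, Lemmas 21–23, (39)–(40)) need the POINTWISE ADELIC companion «il existe `Φ₀ ∈ 𝒮(X_A)` … `|SΦ(x)| ≤ Φ₀(x)` quels
que soient `x ∈ X_A` et `S ∈ Ω`» for a compact `Ω`.  This file turns UNIFORM ALL-ORDER decay data into such a `Φ₀`:

* `exists_isCompact_isOpen_superset` — every compact subset of `(𝔸_F^∞)ⁿ` lies in a COMPACT OPEN one (a common
  denominator `d` and the box `d⁻¹ 𝒪̂ⁿ`; ★ `FiniteAdeleRing.exists_ne_zero_forall_mem_mul_mem`, ★ `integralFiniteAdeles`);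
* `exists_piSchwartzBruhat_dominating_of_uniform_decay` — **if a family `(Ψ_s)_{s ∈ T}` on `𝔸_Fⁿ` satisfies
  `‖Ψ_s x‖ ≤ M_k (1 + ‖x_∞‖)^{-k}` for EVERY `k` and vanishes unless `x_f ∈ C_f` (`C_f` compact), uniformly in `s`,
  then ONE real non-negative `Φ₀ ∈ 𝒮(𝔸_Fⁿ)` satisfies `‖Ψ_s x‖ ≤ (Φ₀ x).re` for all `s ∈ T`, `x`** (archimedean
  factor = the Schwartz envelope of ★ `Analysis/Distribution/SchwartzEnvelope` of the family read through the
  splitting `𝔸_Fⁿ ≅ (F ⊗ ℝ)ⁿ × (𝔸_F^∞)ⁿ`, ★ `piAdeleSplit`; finite factor = `𝟙_D`, `D ⊇ C_f` compact open);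
* `exists_piSchwartzBruhat_dominating_of_mem` — one `Ψ ∈ 𝒮(𝔸_Fⁿ)` (decay data ★ `exists_decay_of_mem_piSchwartzBruhat`);
* CLOSURE under Weil's geometric operators: `norm_chirp_le_of_norm_le` (the chirps `t(S)` are unimodular,
  ★ `norm_chirp_apply`) and `exists_piSchwartzBruhat_dominating_twists_of_dominated` (a family dominated by some
  `Φ₁ ∈ 𝒮` stays dominated after all twists `d(g)`, `g` in a compact — ★ `exists_piSchwartzBruhat_dominating_twists`
  applied to `Φ₁`), so that Bruhat words `chirp ∘ twist ∘ … ` of a dominated family are dominated.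

Cell hodgecm-mathlib, FLOOR 0, engine E-2 (crux item H413, `--supports stmt-HodgeConjecture-24833`), row G3 ∕ (C3) DOM of
the SW2c-BOUND census v2.  HC_CM is proved only modulo the printed citations until rung 0 closes; nothing here is about
Hodge classes.

## References
* [Weil1964] A. Weil, *Sur certains groupes d'opérateurs unitaires*, Acta Math. 111 (1964) 143–211, Chap. III n° 41,
  Lemme 5 p. 194.
* [Weil1965] A. Weil, *Sur la formule de Siegel dans la théorie des groupes classiques*, Acta Math. 113 (1965) 1–87,
  Chap. V n° 50.
-/

set_option autoImplicit false

noncomputable section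

open scoped BigOperators NNReal Matrix Topology Classical RestrictedProduct
open NumberField NumberField.mixedEmbedding IsDedekindDomain Set Filter

namespace Literature.NumberTheory.Weil1964

open Literature.NumberTheory.Automorphic Literature.Analysis.Distribution

variable (F : Type) [Field F] [NumberField F] {n : ℕ}

/-! ## §1 Compact subsets of `(𝔸_F^∞)ⁿ` lie in compact OPEN boxes -/

section Box

/-- **Every compact subset of `(𝔸_F^∞)ⁿ` is contained in a compact open set**: with a common denominator `d ≠ 0` of
all coordinates of the compact set (★ `FiniteAdeleRing.exists_ne_zero_forall_mem_mul_mem`) the box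
`{y : d yᵢ ∈ 𝒪̂ for all i} = (d⁻¹ 𝒪̂)ⁿ` is open (★ `isOpen_integralFiniteAdeles`) and compact (★ `isCompact_integralFiniteAdeles`).
[cite: Weil1964, Chap. III n° 41, Lemme 5 p. 194] -/
theorem exists_isCompact_isOpen_superset {B : Set (Fin n → FiniteAdeleRing (𝓞 F) F)} (hB : IsCompact B) :
    ∃ D : Set (Fin n → FiniteAdeleRing (𝓞 F) F), IsCompact D ∧ IsOpen D ∧ B ⊆ D := by
  -- a common denominator of all coordinates of `B`
  set B' : Set (FiniteAdeleRing (𝓞 F) F) := ⋃ i : Fin n, (fun y : Fin n → FiniteAdeleRing (𝓞 F) F => y i) '' B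
    with hB'
  have hB'c : IsCompact B' := isCompact_iUnion fun i => hB.image (continuous_apply i)
  obtain ⟨d, hd0, hd⟩ := FiniteAdeleRing.exists_ne_zero_forall_mem_mul_mem (K := F) hB'c
  set δ : FiniteAdeleRing (𝓞 F) F := algebraMap (𝓞 F) (FiniteAdeleRing (𝓞 F) F) d with hδ
  -- `δ` is a unit of `𝔸_F^∞`
  have hδu : IsUnit δ := by
    have h1 : δ = algebraMap F (FiniteAdeleRing (𝓞 F) F) (d : F) := by
      rw [hδ, IsScalarTower.algebraMap_apply (𝓞 F) F (FiniteAdeleRing (𝓞 F) F)]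
    rw [h1]
    exact (IsUnit.mk0 (d : F) (by exact_mod_cast hd0)).map _
  obtain ⟨u, hu⟩ := hδu
  -- the box
  set O : Set (FiniteAdeleRing (𝓞 F) F) := {a | δ * a ∈ integralFiniteAdeles F} with hO
  have hOeq : O = (fun b : FiniteAdeleRing (𝓞 F) F => (↑u⁻¹ : FiniteAdeleRing (𝓞 F) F) * b) ''
      (integralFiniteAdeles F : Set (FiniteAdeleRing (𝓞 F) F)) := by
    ext a
    simp only [hO, Set.mem_setOf_eq, Set.mem_image, SetLike.mem_coe]
    constructor
    · intro ha
      refine ⟨δ * a, ha, ?_⟩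
      rw [← hu, ← mul_assoc, Units.inv_mul, one_mul]
    · rintro ⟨b, hb, rfl⟩
      rwa [← hu, ← mul_assoc, Units.mul_inv, one_mul]
  have hOo : IsOpen O := (isOpen_integralFiniteAdeles F).preimage (continuous_const_mul δ)
  have hOc : IsCompact O := by
    rw [hOeq]; exact (isCompact_integralFiniteAdeles F).image (continuous_const_mul _)
  refine ⟨Set.pi Set.univ fun _ => O, isCompact_univ_pi fun _ => hOc, isOpen_set_pi Set.finite_univ fun _ _ => hOo,
    fun y hy i _ => ?_⟩
  change δ * y i ∈ integralFiniteAdeles F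
  exact (mem_integralFiniteAdeles_iff).2 fun v => hd (y i) (Set.mem_iUnion.2 ⟨i, y, hy, rfl⟩) v

end Box

/-! ## §2 Uniform all-order decay data give one Schwartz–Bruhat majorant -/

section Decay

/-- **Uniform decay data ⇒ one Schwartz–Bruhat majorant** (the pointwise adelic form of Weil's Lemme 5 for a family
given by local estimates): if `‖Ψ_s x‖ ≤ M_k (1 + ‖x_∞‖)^{-k}` for every `k`, `s ∈ T`, `x`, and `Ψ_s x = 0` unless
`x_f ∈ C_f` (`C_f` compact), then some `Φ₀ ∈ 𝒮(𝔸_Fⁿ)` with `(Φ₀ x).im = 0 ≤ (Φ₀ x).re` satisfies `‖Ψ_s x‖ ≤ (Φ₀ x).re`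
for all `s ∈ T` and all `x`. [cite: Weil1964, Chap. III n° 41, Lemme 5 p. 194] [cite: Weil1965, Chap. V n° 50] -/
theorem exists_piSchwartzBruhat_dominating_of_uniform_decay {S : Type*} {T : Set S}
    (Ψ : S → (Fin n → AdeleRing (𝓞 F) F) → ℂ) (M : ℕ → ℝ) {Cf : Set (Fin n → FiniteAdeleRing (𝓞 F) F)}
    (hCf : IsCompact Cf)
    (hd : ∀ k : ℕ, ∀ s ∈ T, ∀ x, ‖Ψ s x‖ ≤ M k * (1 + ‖vecInfinitePart F n x‖) ^ (-(k : ℝ)))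
    (hs : ∀ s ∈ T, ∀ x, vecFinitePart F n x ∉ Cf → Ψ s x = 0) :
    ∃ Φ₀ : (Fin n → AdeleRing (𝓞 F) F) → ℂ, Φ₀ ∈ piSchwartzBruhat F (Fin n) ∧
      (∀ x, (Φ₀ x).im = 0 ∧ 0 ≤ (Φ₀ x).re) ∧ ∀ s ∈ T, ∀ x, ‖Ψ s x‖ ≤ (Φ₀ x).re := by
  -- ARCHIMEDEAN: the family `(s, x_f) ↦ (y ↦ Ψ_s (y, x_f))` decays uniformly to every order
  have hdecay : ∀ N : ℕ, ∃ c : ℝ, ∀ p ∈ T ×ˢ (Set.univ : Set (Fin n → FiniteAdeleRing (𝓞 F) F)),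
      ∀ y : Fin n → mixedSpace F, ‖Ψ p.1 (piAdeleSplit F (Fin n) (y, p.2))‖ * (1 + ‖y‖) ^ N ≤ c := by
    intro N
    refine ⟨max (M N) 0, fun p hp y => ?_⟩
    have h := hd N p.1 hp.1 (piAdeleSplit F (Fin n) (y, p.2))
    have hy : vecInfinitePart F n (piAdeleSplit F (Fin n) (y, p.2)) = y := piArch_piAdeleSplit (y, p.2)
    rw [hy] at h
    have hpos : 0 < (1 + ‖y‖) ^ N := pow_pos (by positivity) N
    have h' : ‖Ψ p.1 (piAdeleSplit F (Fin n) (y, p.2))‖ * (1 + ‖y‖) ^ N ≤ M N := by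
      rw [Real.rpow_neg (by positivity), Real.rpow_natCast, ← div_eq_mul_inv, le_div_iff₀ hpos] at h
      exact h
    exact h'.trans (le_max_left _ _)
  obtain ⟨E, hE0, hE⟩ := exists_schwartz_complex_forall_norm_le_of_uniform_rapid_decay
    (S := T ×ˢ (Set.univ : Set (Fin n → FiniteAdeleRing (𝓞 F) F)))
    (F := fun p y => Ψ p.1 (piAdeleSplit F (Fin n) (y, p.2))) hdecay
  -- FINITE: a compact open box around `C_f`
  obtain ⟨D, hDc, hDo, hCD⟩ := exists_isCompact_isOpen_superset F hCf
  haveI : T2Space (FiniteAdeleRing (𝓞 F) F) := inferInstanceAs <| T2Space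
    (Πʳ w : HeightOneSpectrum (𝓞 F), [w.adicCompletion F, w.adicCompletionIntegers F])
  have hind : D.indicator (fun _ => (1 : ℂ)) ∈ SchwartzBruhat (Fin n → FiniteAdeleRing (𝓞 F) F) :=
    indicator_one_mem_schwartzBruhat ⟨hDc.isClosed, hDo⟩ hDc
  refine ⟨fun x => E (piArch F (Fin n) x) * D.indicator (fun _ => (1 : ℂ)) (piFinite F (Fin n) x),
    tensor_mem_piSchwartzBruhat E hind, fun x => ?_, fun s hsT x => ?_⟩
  · change (E (piArch F (Fin n) x) * D.indicator (fun _ => (1 : ℂ)) (piFinite F (Fin n) x)).im = 0 ∧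
      0 ≤ (E (piArch F (Fin n) x) * D.indicator (fun _ => (1 : ℂ)) (piFinite F (Fin n) x)).re
    obtain ⟨him, hre⟩ := hE0 (piArch F (Fin n) x)
    by_cases hx : piFinite F (Fin n) x ∈ D
    · rw [Set.indicator_of_mem hx, mul_one]; exact ⟨him, hre⟩
    · rw [Set.indicator_of_notMem hx, mul_zero]; simp
  · change ‖Ψ s x‖ ≤ (E (piArch F (Fin n) x) * D.indicator (fun _ => (1 : ℂ)) (piFinite F (Fin n) x)).re
    by_cases hxf : vecFinitePart F n x ∈ Cf
    · have hxD : piFinite F (Fin n) x ∈ D := hCD hxf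
      rw [Set.indicator_of_mem hxD, mul_one]
      have hsplit : piAdeleSplit F (Fin n) (piArch F (Fin n) x, piFinite F (Fin n) x) = x := by
        rw [← piAdeleSplit_symm_apply]; exact (piAdeleSplit F (Fin n)).apply_symm_apply x
      have h := hE (s, piFinite F (Fin n) x) ⟨hsT, Set.mem_univ _⟩ (piArch F (Fin n) x)
      rwa [hsplit] at h
    · rw [hs s hsT x hxf, norm_zero]
      obtain ⟨him, hre⟩ := hE0 (piArch F (Fin n) x)
      by_cases hxD : piFinite F (Fin n) x ∈ D
      · rw [Set.indicator_of_mem hxD, mul_one]; exact hre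
      · rw [Set.indicator_of_notMem hxD, mul_zero]; simp

/-- **One Schwartz–Bruhat function is dominated by a real non-negative Schwartz–Bruhat function** (`|Ψ| ≤ Φ₀`), from
its decay data ★ `exists_decay_of_mem_piSchwartzBruhat`. [cite: Weil1964, Chap. III n° 41, Lemme 5 p. 194] -/
theorem exists_piSchwartzBruhat_dominating_of_mem {Ψ : (Fin n → AdeleRing (𝓞 F) F) → ℂ}
    (hΨ : Ψ ∈ piSchwartzBruhat F (Fin n)) :
    ∃ Φ₀ : (Fin n → AdeleRing (𝓞 F) F) → ℂ, Φ₀ ∈ piSchwartzBruhat F (Fin n) ∧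
      (∀ x, (Φ₀ x).im = 0 ∧ 0 ≤ (Φ₀ x).re) ∧ ∀ x, ‖Ψ x‖ ≤ (Φ₀ x).re := by
  -- decay data of all orders, one compact set of finite parts (from the order-`0` datum)
  have hdata := fun k : ℕ => exists_decay_of_mem_piSchwartzBruhat hΨ k
  choose M hM0 Cf hCfc hdM hsM using hdata
  obtain ⟨Φ₀, hΦ₀, hr, hdom⟩ := exists_piSchwartzBruhat_dominating_of_uniform_decay F (S := Unit) (T := Set.univ)
    (fun _ => Ψ) M (hCfc 0) (fun k _ _ x => hdM k x) (fun _ _ x hx => hsM 0 x hx)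
  exact ⟨Φ₀, hΦ₀, hr, fun x => hdom () (Set.mem_univ _) x⟩

end Decay

/-! ## §3 Closure: chirps and twists of dominated families are dominated -/

section Closure

/-- **Chirps preserve domination**: `‖t(S)Ψ (x)‖ = ‖Ψ x‖` (★ `norm_chirp_apply`), so any majorant of a family is a
majorant of all its chirps, `S` arbitrary. [cite: Weil1964, Chap. III n° 41, Lemme 5 p. 194] -/
theorem norm_chirp_le_of_norm_le {Ψ : (Fin n → AdeleRing (𝓞 F) F) → ℂ} {r : (Fin n → AdeleRing (𝓞 F) F) → ℝ}
    (h : ∀ x, ‖Ψ x‖ ≤ r x) (S : Matrix (Fin n) (Fin n) (AdeleRing (𝓞 F) F)) (x : Fin n → AdeleRing (𝓞 F) F) :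
    ‖chirp F S Ψ x‖ ≤ r x := by
  rw [norm_chirp_apply]; exact h x

/-- **Twists of a dominated family are dominated**: if `‖Ψ_s x‖ ≤ (Φ₁ x).re` for all `s ∈ T` with `Φ₁ ∈ 𝒮(𝔸_Fⁿ)`, and
`C ⊆ GL_n(𝔸_F)` is compact, then ONE real non-negative `Φ₀ ∈ 𝒮(𝔸_Fⁿ)` dominates every `twist F g (Ψ s)`, `g ∈ C`,
`s ∈ T` (apply ★ `exists_piSchwartzBruhat_dominating_twists` to `Φ₁`; `|Ψ_s(xg)| ≤ Φ₁(xg) = |Φ₁(xg)|`).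
[cite: Weil1964, Chap. III n° 41, Lemme 5 p. 194] [cite: Weil1965, Chap. V n° 50] -/
theorem exists_piSchwartzBruhat_dominating_twists_of_dominated {S : Type*} {T : Set S}
    {Ψ : S → (Fin n → AdeleRing (𝓞 F) F) → ℂ} {Φ₁ : (Fin n → AdeleRing (𝓞 F) F) → ℂ}
    (hΦ₁ : Φ₁ ∈ piSchwartzBruhat F (Fin n)) (hdom : ∀ s ∈ T, ∀ x, ‖Ψ s x‖ ≤ (Φ₁ x).re)
    {C : Set (GL (Fin n) (AdeleRing (𝓞 F) F))} (hC : IsCompact C) :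
    ∃ Φ₀ : (Fin n → AdeleRing (𝓞 F) F) → ℂ, Φ₀ ∈ piSchwartzBruhat F (Fin n) ∧
      (∀ x, (Φ₀ x).im = 0 ∧ 0 ≤ (Φ₀ x).re) ∧ ∀ g ∈ C, ∀ s ∈ T, ∀ x, ‖twist F g (Ψ s) x‖ ≤ (Φ₀ x).re := by
  obtain ⟨Φ₀, hΦ₀, hr, hd⟩ := exists_piSchwartzBruhat_dominating_twists F hΦ₁ hC
  refine ⟨Φ₀, hΦ₀, hr, fun g hg s hsT x => ?_⟩
  rw [twist_apply]
  refine (hdom s hsT _).trans ?_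
  refine (Complex.re_le_norm _).trans ?_
  simpa only [twist_apply] using hd g hg x

/-- **Chirp–twist words of a dominated family are dominated**: under the hypotheses of
`exists_piSchwartzBruhat_dominating_twists_of_dominated`, ONE `Φ₀` dominates every `t(S) d(g) Ψ_s`
(`S ∈ M_n(𝔸_F)` arbitrary, `g ∈ C`, `s ∈ T`). [cite: Weil1964, Chap. III n° 41, Lemme 5 p. 194] [cite: Weil1965, Chap. V n° 50] -/
theorem exists_piSchwartzBruhat_dominating_chirp_twists_of_dominated {S : Type*} {T : Set S}
    {Ψ : S → (Fin n → AdeleRing (𝓞 F) F) → ℂ} {Φ₁ : (Fin n → AdeleRing (𝓞 F) F) → ℂ}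
    (hΦ₁ : Φ₁ ∈ piSchwartzBruhat F (Fin n)) (hdom : ∀ s ∈ T, ∀ x, ‖Ψ s x‖ ≤ (Φ₁ x).re)
    {C : Set (GL (Fin n) (AdeleRing (𝓞 F) F))} (hC : IsCompact C) :
    ∃ Φ₀ : (Fin n → AdeleRing (𝓞 F) F) → ℂ, Φ₀ ∈ piSchwartzBruhat F (Fin n) ∧
      (∀ x, (Φ₀ x).im = 0 ∧ 0 ≤ (Φ₀ x).re) ∧
        ∀ (Smat : Matrix (Fin n) (Fin n) (AdeleRing (𝓞 F) F)), ∀ g ∈ C, ∀ s ∈ T, ∀ x,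
          ‖chirp F Smat (twist F g (Ψ s)) x‖ ≤ (Φ₀ x).re := by
  obtain ⟨Φ₀, hΦ₀, hr, hd⟩ := exists_piSchwartzBruhat_dominating_twists_of_dominated F hΦ₁ hdom hC
  exact ⟨Φ₀, hΦ₀, hr, fun Smat g hg s hsT x => norm_chirp_le_of_norm_le F (hd g hg s hsT) Smat x⟩

end Closure

end Literature.NumberTheory.Weil1964
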